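import Literature.Analysis.Quadrature.KorobovCBC
import Literature.Computability.Complexity.MedianOfMeans

/-!
# Construction-free median lattice rules (Goda–L'Ecuyer 2022, Theorem 1)

[GodaLecuyer2022] T. Goda and P. L'Ecuyer, *Construction-free median quasi-Monte Carlo rules for
function spaces with unspecified smoothness and general weights*, SIAM J. Sci. Comput. **44**(4)
(2022), A2765–A2788, doi:10.1137/22M1473625 (arXiv:2201.09413), §2 "Lattice rules for Korobov
spaces".

The method (§1): "For a fixed odd integer `r > 0`, we draw `r` generating vectors
independently and uniformly from the set of all admissible generating vectors. For each of them, we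
compute the corresponding QMC approximation `Q_{P_{N,s}}(f)`, then we take the median `M(f)` of
these `r` approximations as our final estimate of `I_s(f)`. Since the method does not require the
explicit construction of a good point set, we call it a *construction-free median QMC rule*."
(§2.1: `M_{N,s,r}(f) := median(Q_{P_{N,s,z_1}}(f), …, Q_{P_{N,s,z_r}}(f))`.)

**Lemma 2.** "For any odd integer `r` and real numbers `a_1, …, a_r`, it holds that
`|median(a_1, …, a_r)| ≤ median(|a_1|, …, |a_r|)`."

**Theorem 1.** "Let `N ≥ 2` be an integer, `r > 0` be an odd integer, and `z_1, …, z_r` be chosen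
independently and randomly from the set `U_N^s` (with replacement). Then, for any `α > 1/2` and
`γ`, the worst-case error of the median rule obeys the following bound:
`e^wor(M_{N,s,r}; F^Kor_{s,α,γ}) ≤ inf_{1/(2α) < λ < 1} ( (1/(η φ(N))) Σ_{∅ ≠ u ⊆ {1,…,s}}
γ_u^{2λ} (2ζ(2αλ))^{|u|} )^{1/(2λ)}`
with a probability of at least `1 - binom(r, (r+1)/2) η^{(r+1)/2}`, for any `0 < η < 1`, where `φ`
and `ζ` denote the Euler totient function and the Riemann zeta function, respectively."

**Remark 1.** "`binom(2k+1, k+1) = (2(2k+1)/(k+1)) binom(2k-1, k) < 4 binom(2k-1, k) < 4^k`.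
Then, for any odd `r ≥ 3`, we have `binom(r, (r+1)/2) η^{(r+1)/2} < (4η)^{(r+1)/2}/4`."

**Corollary 1.** "For any odd `r ≥ 3`, `ε > 0`, and `0 < ρ < 1`, there is a constant
`c_1 = c_1(α, γ, ε) > 0` … such that
`P[ e^wor(M_{N,s,r}; F^Kor_{s,α,γ}) ≤ c_1(α,γ,ε)/(ρN)^{α-ε} ] ≥ 1 - ρ^{(r+1)/2}/4`."
(Proof: "For prime `N`, we have `φ(N) = N - 1` and the corollary follows from Theorem 1 and the
bound (7) in Remark 1.")

**Remark 3.** "a proportion of the generating vectors `z` which satisfy the bound of order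
`N^{-α+ε}` … is greater than or equal to `1 - η`, for any `0 < η < 1`. On the other hand, the
averaging argument in the proof of Theorem 1 with `λ = 1` gives
`(1/φ(N)^s) Σ_{z ∈ U_N^s} (S_{α,γ}(z))² ≤ (1/φ(N)) Σ_{∅ ≠ u} γ_u² (2ζ(2α))^{|u|}`."
("the result for `r = 1`, i.e., the case without taking the median, can be found, for instance, in
[DSWW06]".)

## Setting of this file (the specialisation that is formalised)

* **Prime `N` and product weights.** We formalise the case of a *prime* number of points `N`
  (then `U_N = {1, …, N-1}` and `φ(N) = N - 1`, cf. `int_gcd_eq_one_of_mem_cbcCandidates`) and of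
  *product weights* `γ_u = ∏_{j ∈ u} γ_j` (then
  `Σ_{∅ ≠ u} γ_u^{2λ} (2ζ(2αλ))^{|u|} = ∏_j (1 + 2γ_j^{2λ} ζ(2αλ)) - 1`).
* **Dictionary with the tree's Korobov-space files.** In the parametrisation of
  `KorobovCBC` / `KorobovBernoulliForm` (Dick–Pillichshammer: `r_{a,γ}(h)^{-1} = ∏_{h_j ≠ 0} γ_j/|h_j|^a`,
  `korobovWeightR a γ h`), the squared weight `(r_{α,γ}(k))²` of [GodaLecuyer2022, Def. 2] is
  `korobovWeightR a γ k` with `a = 2α > 1` and `γ_j ↦ γ_j²`.  Hence the squared quantity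
  `(S_{α,γ}(z))² = Σ_{0 ≠ k ∈ P^⊥_{N,s,z}} (r_{α,γ}(k))²` of the proof of Theorem 1 is
  `weightedPFigureR a γ z N` (= `e²` of `KorobovCBC`), the squared Korobov norm
  `(‖f‖^Kor)² = Σ_k |f̂(k)|²/(r_{α,γ}(k))²` is `korobovNormSq a γ f`, the exponent `λ ∈ (1/(2α), 1]`
  is `l` with `1 < a·l`, `l ≤ 1`, and `2ζ(2αλ) γ_u^{2λ}` becomes `2 γ_j^l ζ(a l)` per coordinate.
  The bound of Theorem 1 for a fixed `λ`, *squared*, is `errorBoundSq a γ N l η`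
  (`= ((∏_j (1 + 2γ_j^l ζ(al)) - 1)/(η (N-1)))^{1/l}`).
* **Probability as counting.** "chosen independently and randomly from `U_N^s` (with
  replacement)" is the uniform distribution on `Ω = ({1,…,N-1}^s)^r`; all probabilistic statements
  are stated as cardinality bounds `#{ω ∈ Ω | …} ≤ p · #Ω`.
* The integrand is a real continuous function on `𝕋ˢ = (ℝ/ℤ)ˢ` ("periodic with an absolutely
  convergent Fourier series"; absolute convergence follows from the finiteness of the Korobov norm,
  `summable_mFourierCoeff_of_korobovNormSq`); its Fourier coefficients are those of its
  complexification `toComplex f`.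

## Formalised content

* `median`, `median_le_iff`, `le_median_iff`, `lt_median_iff`, `median_mono`,
  `median_comp_of_monotone`, **Lemma 2** `abs_median_le_median_abs`, and the link
  `isMedian_median` with `Literature.Computability.Complexity.IsMedian` (median-of-means file).
* The averaging argument (proof of Theorem 1 / Remark 3 with general `λ`):
  `sum_genVectors_weightedPFigureR_le`
  (`Σ_{z ∈ {1..N-1}^s} e²_{b,δ}(z) ≤ (N-1)^s · (∏_j (1 + 2δ_j ζ(b)) - 1)/(N-1)`, prime `N`, `b > 1`),
  Jensen/subadditivity `weightedPFigureR_rpow_le`, and **Markov's inequality**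
  `card_filter_errorBoundSq_lt_le` (`#{z : e²(z) > B²} ≤ η · (N-1)^s`; Remark 3 / the case `r = 1`:
  `card_filter_le_errorBoundSq_ge`).
* The union bound over sets of `(r+1)/2` indices: `card_filter_le_card_filter_mem_le`
  (`#{ω ∈ Z^r : #{ℓ : ω_ℓ ∈ B} ≥ m} ≤ binom(r,m) (#B)^m (#Z)^{r-m}`).
* **Remark 1**: `choose_middle_le_four_pow` (`binom(2k+1,k+1) ≤ 4^k`), `choose_middle_lt_four_pow`
  (strict for `k ≥ 1`, i.e. `r ≥ 3`), `choose_mul_pow_le` (`binom(r,(r+1)/2) η^{(r+1)/2} ≤ (4η)^{(r+1)/2}/4`).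
* The Cauchy–Schwarz step (4): `norm_latticeRule_sub_integral_le_sqrt_mul_sqrt`
  (`|Q_{N,z}(f) - I(f)| ≤ ‖f‖^Kor · S_{α,γ}(z)`), its real form `abs_latticeRule_sub_integral_le`,
  and the deterministic median bound `abs_medianLatticeRule_sub_integral_le`
  (`|M_{N,s,r}(f) - I(f)| ≤ ‖f‖^Kor · median_ℓ S_{α,γ}(z_ℓ)`).
* **Theorem 1** (prime `N`, product weights, fixed `λ`): `medianLatticeRule_theorem_one` — the set of
  draws `ω ∈ Ω` with `median_ℓ e²(z_ℓ) > B²` has at most `binom(r,(r+1)/2) η^{(r+1)/2} #Ω` elements,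
  and for every other draw `|M_{N,s,r}(f) - I(f)| ≤ ‖f‖^Kor · B` for all `f` of finite Korobov norm.
* **Corollary 1** (prime `N`): `medianLatticeRule_corollary_one` with the explicit constant
  `c_1 = (8 (∏_j (1 + 2γ_j^l ζ(al)) - 1))^{1/(2l)}` and exponent `1/(2l) = α - ε ∈ [1/2, α)`.

## Not formalised

General (non-product) weights `γ_u` and composite `N` (these need the exponential-sum estimate of
[KJ02] over `U_N` and, for Corollary 1, the Rosser–Schoenfeld bound on `1/φ(N)`); the infimum over
`λ` (we state the bound for every admissible `λ`, which is equivalent); the identification of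
`S_{α,γ}(z)` with the worst-case error (Remark 3, [DKS13]) and the reproducing-kernel description
of `F^Kor` (Definition 2) — we work directly with the Fourier-side norm; §3 (polynomial lattice
rules, Theorem 2) and §4 (numerics); Remarks 4–5.

## References

* [GodaLecuyer2022] T. Goda, P. L'Ecuyer, SIAM J. Sci. Comput. 44(4) (2022) A2765–A2788.
* [DickPillichshammer2014] J. Dick, F. Pillichshammer, *Digital Nets and Sequences* — the
  parametrisation of `KorobovCBC` (Theorems 15, 21).
* [DSWW06] J. Dick, I. H. Sloan, X. Wang, H. Woźniakowski, Numer. Math. 103 (2006) — the case `r = 1`.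

AI-produced formalisation (no `sorry`); the quoted sentences above are verbatim from the arXiv
version of [GodaLecuyer2022], everything else is this file's paraphrase.
-/

open scoped Real
open Finset MeasureTheory UnitAddTorus

noncomputable section

namespace Literature.Analysis.Quadrature

attribute [local instance] latticeRules_measureSpace latticeRules_isAddHaarMeasure
  latticeRules_isProbabilityMeasure

/-! ### The median of an odd number of values and Lemma 2 -/

section Median

variable {α : Type*} [LinearOrder α] {k : ℕ}

/-- The middle position `k` (0-based) among `2k+1` sorted values. [folklore] -/
def midIndex (k : ℕ) : Fin (2 * k + 1) :=
  ⟨k, by omega⟩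

/-- The middle position has index `k`. [folklore] -/
@[simp] private theorem val_midIndex (k : ℕ) : (midIndex k : ℕ) = k := rfl

/-- The median of `r = 2k+1` values `a_0, …, a_{2k}` of a linear order: the `(k+1)`-th smallest
value, i.e. the middle entry of the sorted tuple ("Because `r` is odd, the median is unique").
[cite: GodaLecuyer2022, Lemma 2] -/
def median (a : Fin (2 * k + 1) → α) : α :=
  a (Tuple.sort a (midIndex k))

/-- The median is one of the values. [cite: GodaLecuyer2022, Lemma 2 (proof)] -/
theorem exists_median_eq (a : Fin (2 * k + 1) → α) : ∃ i, median a = a i :=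
  ⟨_, rfl⟩

/-- Counting positions is invariant under a permutation of the indices. [folklore] -/
private theorem card_filter_comp_perm {n : ℕ} (q : Fin n → Prop) [DecidablePred q]
    (σ : Equiv.Perm (Fin n)) :
    (univ.filter fun i => q (σ i)).card = (univ.filter q).card :=
  Finset.card_bij (fun i _ => σ i) (fun i hi => by simpa using hi)
    (fun i _ j _ h => σ.injective h) fun j hj => ⟨σ.symm j, by simpa using hj, by simp⟩

/-- `median(a) ≤ t` iff at least `k+1` of the `2k+1` values are `≤ t` (the counting behind "there
are at least `(r-1)/2` other `a_ℓ`'s for which `a_ℓ ≤ a_m`"). [cite: GodaLecuyer2022, Lemma 2 (proof)] -/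
theorem median_le_iff {a : Fin (2 * k + 1) → α} {t : α} :
    median a ≤ t ↔ k + 1 ≤ (univ.filter fun i => a i ≤ t).card := by
  rw [← card_filter_comp_perm (fun i => a i ≤ t) (Tuple.sort a)]
  have hmono : Monotone (a ∘ Tuple.sort a) := Tuple.monotone_sort a
  constructor
  · intro h
    have hsub : Finset.Iic (midIndex k) ⊆ univ.filter fun i => a (Tuple.sort a i) ≤ t := by
      intro i hi
      rw [Finset.mem_Iic] at hi
      exact mem_filter.mpr ⟨mem_univ _, (hmono hi).trans h⟩
    have := card_le_card hsub
    rw [Fin.card_Iic, val_midIndex] at this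
    exact this
  · intro h
    refine not_lt.mp fun hlt => ?_
    have hsub : (univ.filter fun i => a (Tuple.sort a i) ≤ t) ⊆ Finset.Iio (midIndex k) := by
      intro i hi
      rw [mem_filter] at hi
      rw [Finset.mem_Iio]
      refine not_le.mp fun hge => ?_
      exact absurd hi.2 (not_le.mpr (lt_of_lt_of_le hlt (hmono hge)))
    have := card_le_card hsub
    rw [Fin.card_Iio, val_midIndex] at this
    omega

/-- `t ≤ median(a)` iff at least `k+1` of the `2k+1` values are `≥ t`.
[cite: GodaLecuyer2022, Lemma 2 (proof)] -/
theorem le_median_iff {a : Fin (2 * k + 1) → α} {t : α} :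
    t ≤ median a ↔ k + 1 ≤ (univ.filter fun i => t ≤ a i).card := by
  rw [← card_filter_comp_perm (fun i => t ≤ a i) (Tuple.sort a)]
  have hmono : Monotone (a ∘ Tuple.sort a) := Tuple.monotone_sort a
  constructor
  · intro h
    have hsub : Finset.Ici (midIndex k) ⊆ univ.filter fun i => t ≤ a (Tuple.sort a i) := by
      intro i hi
      rw [Finset.mem_Ici] at hi
      exact mem_filter.mpr ⟨mem_univ _, h.trans (hmono hi)⟩
    have := card_le_card hsub
    rw [Fin.card_Ici, val_midIndex] at this
    omega
  · intro h
    refine not_lt.mp fun hlt => ?_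
    have hsub : (univ.filter fun i => t ≤ a (Tuple.sort a i)) ⊆ Finset.Ioi (midIndex k) := by
      intro i hi
      rw [mem_filter] at hi
      rw [Finset.mem_Ioi]
      refine not_le.mp fun hge => ?_
      exact absurd hi.2 (not_le.mpr (lt_of_le_of_lt (hmono hge) hlt))
    have := card_le_card hsub
    rw [Fin.card_Ioi, val_midIndex] at this
    omega

/-- `t < median(a)` iff at least `k+1` of the `2k+1` values are `> t` ("For the median estimator
to be larger than this bound, we must have `S(z_ℓ) > B` for at least `(r+1)/2` vectors among
`z_1, …, z_r`"). [cite: GodaLecuyer2022, Thm. 1 (proof)] -/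
theorem lt_median_iff {a : Fin (2 * k + 1) → α} {t : α} :
    t < median a ↔ k + 1 ≤ (univ.filter fun i => t < a i).card := by
  rw [← not_le, median_le_iff, not_le]
  have h := Finset.card_filter_add_card_filter_not (s := (univ : Finset (Fin (2 * k + 1))))
    (fun i => a i ≤ t)
  simp only [not_le, card_univ, Fintype.card_fin] at h
  omega

/-- `median(a) < t` iff at least `k+1` of the `2k+1` values are `< t`.
[cite: GodaLecuyer2022, Lemma 2 (proof)] -/
theorem median_lt_iff {a : Fin (2 * k + 1) → α} {t : α} :
    median a < t ↔ k + 1 ≤ (univ.filter fun i => a i < t).card := by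
  rw [← not_le, le_median_iff, not_le]
  have h := Finset.card_filter_add_card_filter_not (s := (univ : Finset (Fin (2 * k + 1))))
    (fun i => t ≤ a i)
  simp only [not_le, card_univ, Fintype.card_fin] at h
  omega

/-- The median is monotone in the values (used in (4): `median_ℓ x_ℓ ≤ median_ℓ y_ℓ` when
`x_ℓ ≤ y_ℓ`). [cite: GodaLecuyer2022, Thm. 1 (proof)] -/
theorem median_mono {a b : Fin (2 * k + 1) → α} (h : ∀ i, a i ≤ b i) : median a ≤ median b := by
  refine median_le_iff.mpr ((median_le_iff.mp (le_refl (median b))).trans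
    (card_le_card fun i hi => ?_))
  simp only [mem_filter, mem_univ, true_and] at hi ⊢
  exact (h i).trans hi

/-- A monotone map commutes with the median: `median(φ(a_1), …, φ(a_r)) = φ(median(a_1, …, a_r))`
(used in (4) with `x ↦ x - I(f)`, `x ↦ ‖f‖·x` and `x ↦ √x`). [cite: GodaLecuyer2022, Thm. 1 (proof)] -/
theorem median_comp_of_monotone {β : Type*} [LinearOrder β] {φ : α → β} (hφ : Monotone φ)
    (a : Fin (2 * k + 1) → α) : median (fun i => φ (a i)) = φ (median a) := by
  refine le_antisymm ?_ ?_
  · refine median_le_iff.mpr ((median_le_iff.mp (le_refl (median a))).trans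
      (card_le_card fun i hi => ?_))
    simp only [mem_filter, mem_univ, true_and] at hi ⊢
    exact hφ hi
  · refine le_median_iff.mpr ((le_median_iff.mp (le_refl (median a))).trans
      (card_le_card fun i hi => ?_))
    simp only [mem_filter, mem_univ, true_and] at hi ⊢
    exact hφ hi

/-- **Lemma 2** [cite: GodaLecuyer2022, Lemma 2]: "For any odd integer `r` and real numbers
`a_1, …, a_r`, it holds that `|median(a_1, …, a_r)| ≤ median(|a_1|, …, |a_r|)`." -/
theorem abs_median_le_median_abs (a : Fin (2 * k + 1) → ℝ) :
    |median a| ≤ median (fun i => |a i|) := by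
  refine abs_le.mpr ⟨?_, median_mono fun i => le_abs_self _⟩
  rw [neg_le]
  refine le_median_iff.mpr ((median_le_iff.mp (le_refl (median a))).trans
    (card_le_card fun i hi => ?_))
  simp only [mem_filter, mem_univ, true_and] at hi ⊢
  exact (neg_le_neg hi).trans (neg_le_abs _)

/-- The middle order statistic is a median in the sense of the median-of-means file (at most half
the values strictly below, at most half strictly above; "Because `r` is odd, the median is
unique"). [cite: GodaLecuyer2022, Lemma 2] -/
theorem isMedian_median (v : Fin (2 * k + 1) → ℝ) :
    Literature.Computability.Complexity.IsMedian v (median v) := by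
  constructor
  · have h1 := le_median_iff.mp (le_refl (median v))
    have h2 := Finset.card_filter_add_card_filter_not (s := (univ : Finset (Fin (2 * k + 1))))
      (fun i => median v ≤ v i)
    simp only [not_le, card_univ, Fintype.card_fin] at h2
    omega
  · have h1 := median_le_iff.mp (le_refl (median v))
    have h2 := Finset.card_filter_add_card_filter_not (s := (univ : Finset (Fin (2 * k + 1))))
      (fun i => v i ≤ median v)
    simp only [not_le, card_univ, Fintype.card_fin] at h2
    omega

end Median

/-! ### Remark 1: `binom(2k+1, k+1) < 4^k` and the union bound over `(r+1)/2`-subsets -/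

/-- `binom(2k+1, k+1) ≤ 4^k` (from `Σ_j binom(2k+1, j) = 2^{2k+1}` and the symmetry
`binom(2k+1, k) = binom(2k+1, k+1)`). [cite: GodaLecuyer2022, Remark 1] -/
theorem choose_middle_le_four_pow (k : ℕ) : (2 * k + 1).choose (k + 1) ≤ 4 ^ k := by
  have hsum := Nat.sum_range_choose (2 * k + 1)
  have hsym := Nat.choose_symm_half k
  have hsub : ({k, k + 1} : Finset ℕ) ⊆ range (2 * k + 1 + 1) := by
    intro x hx
    simp only [mem_insert, mem_singleton] at hx
    rw [mem_range]
    omega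
  have h2 := Finset.sum_le_sum_of_subset (f := fun m => (2 * k + 1).choose m) hsub
  rw [Finset.sum_pair (by omega : k ≠ k + 1), hsum] at h2
  have h4 : (4 : ℕ) ^ k = 2 ^ (2 * k) := by
    rw [pow_mul]
    norm_num
  have h5 : (2 : ℕ) ^ (2 * k + 1) = 2 * 2 ^ (2 * k) := by ring
  omega

/-- "`binom(2k+1, k+1) … < 4^k`" for `k ≥ 1` (i.e. odd `r = 2k+1 ≥ 3`).
[cite: GodaLecuyer2022, Remark 1] -/
theorem choose_middle_lt_four_pow {k : ℕ} (hk : 1 ≤ k) : (2 * k + 1).choose (k + 1) < 4 ^ k := by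
  have hsum := Nat.sum_range_choose (2 * k + 1)
  have hsym := Nat.choose_symm_half k
  have hsub : ({0, k, k + 1, 2 * k + 1} : Finset ℕ) ⊆ range (2 * k + 1 + 1) := by
    intro x hx
    simp only [mem_insert, mem_singleton] at hx
    rw [mem_range]
    omega
  have h2 := Finset.sum_le_sum_of_subset (f := fun m => (2 * k + 1).choose m) hsub
  rw [Finset.sum_insert (by simp only [mem_insert, mem_singleton]; omega),
    Finset.sum_insert (by simp only [mem_insert, mem_singleton]; omega),
    Finset.sum_pair (by omega : k + 1 ≠ 2 * k + 1), hsum, Nat.choose_zero_right,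
    Nat.choose_self] at h2
  have h4 : (4 : ℕ) ^ k = 2 ^ (2 * k) := by
    rw [pow_mul]
    norm_num
  have h5 : (2 : ℕ) ^ (2 * k + 1) = 2 * 2 ^ (2 * k) := by ring
  omega

/-- "(7) `binom(r, (r+1)/2) η^{(r+1)/2} < (4η)^{(r+1)/2}/4`" — here with `≤`, valid for every odd
`r = 2k+1 ≥ 1` and `η ≥ 0`. [cite: GodaLecuyer2022, Remark 1] -/
theorem choose_mul_pow_le (k : ℕ) {η : ℝ} (hη : 0 ≤ η) :
    ((2 * k + 1).choose (k + 1) : ℝ) * η ^ (k + 1) ≤ (4 * η) ^ (k + 1) / 4 := by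
  have h1 : ((2 * k + 1).choose (k + 1) : ℝ) ≤ (4 : ℝ) ^ k := by
    exact_mod_cast choose_middle_le_four_pow k
  have h2 : (4 * η) ^ (k + 1) / 4 = (4 : ℝ) ^ k * η ^ (k + 1) := by
    rw [mul_pow, pow_succ]
    ring
  rw [h2]
  exact mul_le_mul_of_nonneg_right h1 (pow_nonneg hη _)

/-- **The union bound of the proof of Theorem 1**: among the `r`-tuples `ω ∈ Z^r`, those with at
least `m` coordinates in a finite set `B` number at most `binom(r, m) (#B)^m (#Z)^{r-m}` ("Taking
the union bound on possible sets of `(r+1)/2` vectors with `S(z_ℓ) > B`, the probability that this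
happens is bounded above by `binom(r,(r+1)/2) η^{(r+1)/2}`"). [cite: GodaLecuyer2022, Thm. 1 (proof)] -/
theorem card_filter_le_card_filter_mem_le {ι : Type*} [DecidableEq ι] (Z B : Finset ι)
    (r m : ℕ) :
    ((Fintype.piFinset fun _ : Fin r => Z).filter
        (fun ω => m ≤ (univ.filter fun ℓ => ω ℓ ∈ B).card)).card ≤
      r.choose m * B.card ^ m * Z.card ^ (r - m) := by
  classical
  have hcover : ((Fintype.piFinset fun _ : Fin r => Z).filter
      (fun ω => m ≤ (univ.filter fun ℓ => ω ℓ ∈ B).card)) ⊆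
      ((univ : Finset (Fin r)).powersetCard m).biUnion
        (fun S => Fintype.piFinset fun ℓ => if ℓ ∈ S then B else Z) := by
    intro ω hω
    rw [mem_filter, Fintype.mem_piFinset] at hω
    obtain ⟨S, hSsub, hScard⟩ := Finset.exists_subset_card_eq hω.2
    rw [mem_biUnion]
    refine ⟨S, mem_powersetCard.mpr ⟨fun _ _ => mem_univ _, hScard⟩,
      Fintype.mem_piFinset.mpr fun ℓ => ?_⟩
    split_ifs with hℓ
    · exact (mem_filter.mp (hSsub hℓ)).2
    · exact hω.1 ℓ
  refine (card_le_card hcover).trans (card_biUnion_le.trans ?_)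
  have hterm : ∀ S ∈ (univ : Finset (Fin r)).powersetCard m,
      (Fintype.piFinset fun ℓ => if ℓ ∈ S then B else Z).card = B.card ^ m * Z.card ^ (r - m) := by
    intro S hS
    rw [mem_powersetCard] at hS
    rw [Fintype.card_piFinset]
    have h1 : ∀ ℓ : Fin r, (if ℓ ∈ S then B else Z).card = if ℓ ∈ S then B.card else Z.card := by
      intro ℓ
      split_ifs <;> rfl
    simp_rw [h1]
    rw [Finset.prod_ite, Finset.prod_const, Finset.prod_const, Finset.filter_mem_eq_inter,
      Finset.univ_inter, hS.2, Finset.filter_not, Finset.filter_mem_eq_inter, Finset.univ_inter,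
      Finset.card_univ_sdiff, Fintype.card_fin, hS.2]
  rw [Finset.sum_congr rfl hterm, sum_const, card_powersetCard, card_univ, Fintype.card_fin,
    smul_eq_mul, mul_assoc]

/-! ### Generating vectors `{1, …, N-1}^s` and the averaging argument -/

section Averaging

variable {d : Type*} [Fintype d]

/-- `ζ(k) ≥ 0`. [folklore] -/
private theorem zetaReal_nonneg'' (k : ℝ) : 0 ≤ zetaReal k := by
  unfold zetaReal
  exact tsum_nonneg fun n => inv_nonneg.mpr (Real.rpow_nonneg (Nat.cast_nonneg n) k)

/-- The set `{1, …, N-1}^s` of generating vectors; for prime `N` this is `U_N^s`,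
`U_N = {1 ≤ z ≤ N-1 | gcd(z, N) = 1}`. [cite: GodaLecuyer2022, Def. 1] -/
def genVectors (s N : ℕ) : Finset (Fin s → ℤ) :=
  Fintype.piFinset fun _ : Fin s => cbcCandidates N

/-- `z ∈ {1,…,N-1}^s ↔ ∀ j, 1 ≤ z_j ≤ N-1`. [cite: GodaLecuyer2022, Def. 1] -/
theorem mem_genVectors {s N : ℕ} {z : Fin s → ℤ} :
    z ∈ genVectors s N ↔ ∀ j, z j ∈ cbcCandidates N :=
  Fintype.mem_piFinset

/-- "the cardinality of `U_N` is equal to `φ(N)`": `#{1,…,N-1}^s = (N-1)^s`.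
[cite: GodaLecuyer2022, Thm. 1 (proof)] -/
theorem card_genVectors (s N : ℕ) : (genVectors s N).card = (N - 1) ^ s := by
  rw [genVectors, Fintype.card_piFinset, prod_const, card_cbcCandidates, card_univ, Fintype.card_fin]

/-- For prime `N` every `z ∈ {1, …, N-1}` is coprime to `N`, i.e. `{1,…,N-1} = U_N`.
[cite: GodaLecuyer2022, §2.1] -/
theorem int_gcd_eq_one_of_mem_cbcCandidates {N : ℕ} (hN : N.Prime) {w : ℤ}
    (hw : w ∈ cbcCandidates N) : Int.gcd w N = 1 := by
  rw [mem_cbcCandidates] at hw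
  have hw0 : (w.natAbs : ℤ) = w := Int.natAbs_of_nonneg (by omega)
  have h1 : ¬ N ∣ w.natAbs := by
    intro h
    have hpos : 0 < w.natAbs := Int.natAbs_pos.mpr (by omega)
    have h2 : (N : ℤ) ≤ (w.natAbs : ℤ) := by exact_mod_cast Nat.le_of_dvd hpos h
    omega
  have h3 : Nat.Coprime N w.natAbs := hN.coprime_iff_not_dvd.mpr h1
  rw [Int.gcd_comm]
  exact h3

/-- Splitting off the last component: `Σ_{z ∈ {1..N-1}^{s+1}} F(z) = Σ_{z'} Σ_{w} F((z', w))`.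
[folklore] -/
private theorem sum_genVectors_succ (s N : ℕ) (F : (Fin (s + 1) → ℤ) → ℝ) :
    ∑ z ∈ genVectors (s + 1) N, F z =
      ∑ z' ∈ genVectors s N, ∑ w ∈ cbcCandidates N, F (Fin.snoc z' w) := by
  have h1 : ∑ p ∈ cbcCandidates N ×ˢ genVectors s N, F (Fin.snoc p.2 p.1) =
      ∑ z' ∈ genVectors s N, ∑ w ∈ cbcCandidates N, F (Fin.snoc z' w) :=
    Finset.sum_product_right _ _ _
  rw [← h1]
  symm
  refine Finset.sum_equiv (Fin.snocEquiv fun _ : Fin (s + 1) => ℤ) (fun p => ?_) (fun p _ => rfl)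
  rw [Finset.mem_product, genVectors, genVectors, Fin.mem_piFinset_iff_last_init]
  simp [Fin.init]

/-- **The averaging argument** (proof of Theorem 1; Remark 3 for `λ = 1`), product weights and
prime `N`: `(1/(N-1)^s) Σ_{z ∈ U_N^s} e²_{b,δ}(z) ≤ (∏_j (1 + 2δ_j ζ(b)) - 1)/(N - 1)` for `b > 1`,
`δ ≥ 0` — by induction on `s` from `e²((z', w)) = e²(z') + θ(z'; w)` and
`Σ_w θ(z'; w) ≤ 2δ_s ζ(b) ∏_{j<s}(1 + 2δ_j ζ(b))` of `KorobovCBC`.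
[cite: GodaLecuyer2022, Thm. 1 (proof)] -/
theorem sum_genVectors_weightedPFigureR_le {b : ℝ} (hb : 1 < b) {N : ℕ} (hN : N.Prime) :
    ∀ (s : ℕ) {δ : Fin s → ℝ}, (∀ i, 0 ≤ δ i) →
      ∑ z ∈ genVectors s N, weightedPFigureR b δ z N ≤
        ((N : ℝ) - 1) ^ s * (((∏ j, (1 + 2 * δ j * zetaReal b)) - 1) / ((N : ℝ) - 1)) := by
  intro s
  induction s with
  | zero =>
    intro δ _
    simp [weightedPFigureR_fin_zero]
  | succ s ih =>
    intro δ hδ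
    have h2 : (2 : ℝ) ≤ N := by exact_mod_cast hN.two_le
    have hN1 : (0 : ℝ) < (N : ℝ) - 1 := by linarith
    have hcast : ((N - 1 : ℕ) : ℝ) = (N : ℝ) - 1 := by
      rw [Nat.cast_sub hN.one_lt.le, Nat.cast_one]
    have hδ' : ∀ i : Fin s, 0 ≤ (fun j : Fin s => δ j.castSucc) i := fun i => hδ _
    have hIH := ih hδ'
    have hθ : ∀ z' : Fin s → ℤ, ∑ w ∈ cbcCandidates N, cbcTheta b δ N z' w ≤
        2 * δ (Fin.last s) * zetaReal b * ∏ j : Fin s, (1 + 2 * δ j.castSucc * zetaReal b) :=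
      fun z' => sum_cbcTheta_le hb hδ hN z'
    calc ∑ z ∈ genVectors (s + 1) N, weightedPFigureR b δ z N
        = ∑ z' ∈ genVectors s N, ∑ w ∈ cbcCandidates N,
            (weightedPFigureR b (fun j : Fin s => δ j.castSucc) z' N + cbcTheta b δ N z' w) := by
          rw [sum_genVectors_succ]
          refine Finset.sum_congr rfl fun z' _ => Finset.sum_congr rfl fun w _ => ?_
          exact weightedPFigureR_snoc hb δ N z' w
      _ = ∑ z' ∈ genVectors s N, (((N : ℝ) - 1) * weightedPFigureR b (fun j : Fin s => δ j.castSucc) z' N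
            + ∑ w ∈ cbcCandidates N, cbcTheta b δ N z' w) := by
          refine Finset.sum_congr rfl fun z' _ => ?_
          rw [Finset.sum_add_distrib, Finset.sum_const, card_cbcCandidates, nsmul_eq_mul, hcast]
      _ ≤ ∑ z' ∈ genVectors s N, (((N : ℝ) - 1) * weightedPFigureR b (fun j : Fin s => δ j.castSucc) z' N
            + 2 * δ (Fin.last s) * zetaReal b * ∏ j : Fin s, (1 + 2 * δ j.castSucc * zetaReal b)) :=
          Finset.sum_le_sum fun z' _ => add_le_add le_rfl (hθ z')
      _ = ((N : ℝ) - 1) * ∑ z' ∈ genVectors s N, weightedPFigureR b (fun j : Fin s => δ j.castSucc) z' N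
            + ((N : ℝ) - 1) ^ s *
              (2 * δ (Fin.last s) * zetaReal b * ∏ j : Fin s, (1 + 2 * δ j.castSucc * zetaReal b)) := by
          rw [Finset.sum_add_distrib, ← Finset.mul_sum, Finset.sum_const, card_genVectors,
            nsmul_eq_mul, Nat.cast_pow, hcast]
      _ ≤ ((N : ℝ) - 1) * (((N : ℝ) - 1) ^ s *
              (((∏ j : Fin s, (1 + 2 * δ j.castSucc * zetaReal b)) - 1) / ((N : ℝ) - 1)))
            + ((N : ℝ) - 1) ^ s *
              (2 * δ (Fin.last s) * zetaReal b * ∏ j : Fin s, (1 + 2 * δ j.castSucc * zetaReal b)) :=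
          add_le_add (mul_le_mul_of_nonneg_left hIH hN1.le) le_rfl
      _ = ((N : ℝ) - 1) ^ (s + 1) * (((∏ j, (1 + 2 * δ j * zetaReal b)) - 1) / ((N : ℝ) - 1)) := by
          rw [Fin.prod_univ_castSucc]
          set Pr := ∏ j : Fin s, (1 + 2 * δ j.castSucc * zetaReal b) with hPr
          rw [pow_succ]
          field_simp
          ring

/-- Jensen's inequality / subadditivity (5) applied to `e²`:
`(e²_{a,γ}(z))^λ ≤ e²_{aλ,γ^λ}(z)` for `0 < λ ≤ 1`, `aλ > 1`
("by using the subadditivity `(Σ_i a_i)^λ ≤ Σ_i a_i^λ`"). [cite: GodaLecuyer2022, Thm. 1 (proof)] -/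
theorem weightedPFigureR_rpow_le {a l : ℝ} (hl0 : 0 < l) (hl1 : l ≤ 1) (hal : 1 < a * l)
    {γ : d → ℝ} (hγ : ∀ i, 0 ≤ γ i) (g : d → ℤ) (N : ℕ) :
    weightedPFigureR a γ g N ^ l ≤ weightedPFigureR (a * l) (fun i => γ i ^ l) g N := by
  unfold weightedPFigureR
  have hs : Summable fun h : ((dualLattice N g : Set (d → ℤ)) \ {0} : Set (d → ℤ)) =>
      korobovWeightR a γ (h : d → ℤ) ^ l := by
    simp_rw [korobovWeightR_rpow a hγ _ l]
    exact (summable_korobovWeightR hal _).subtype _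
  calc (∑' h : ((dualLattice N g : Set (d → ℤ)) \ {0} : Set (d → ℤ)), korobovWeightR a γ h) ^ l
      ≤ ∑' h : ((dualLattice N g : Set (d → ℤ)) \ {0} : Set (d → ℤ)), korobovWeightR a γ h ^ l :=
        rpow_tsum_le_tsum_rpow_of_le_one (fun h => korobovWeightR_nonneg a hγ _) hl0 hl1 hs
    _ = _ := tsum_congr fun h => korobovWeightR_rpow a hγ _ l

/-- The squared bound of Theorem 1 for a fixed `λ` (product weights, prime `N`):
`B_λ² = ((∏_j (1 + 2γ_j^λ ζ(aλ)) - 1) / (η (N - 1)))^{1/λ}`, the threshold for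
`(S_{α,γ}(z))² = e²_{a,γ}(z)` (`a = 2α`). [cite: GodaLecuyer2022, Thm. 1] -/
def errorBoundSq {s : ℕ} (a : ℝ) (γ : Fin s → ℝ) (N : ℕ) (l η : ℝ) : ℝ :=
  (((∏ j, (1 + 2 * γ j ^ l * zetaReal (a * l))) - 1) / (η * ((N : ℝ) - 1))) ^ l⁻¹

/-- `∏_j (1 + 2γ_j^λ ζ(aλ)) ≥ 1`. [folklore] -/
private theorem one_le_prod_weights {s : ℕ} (a l : ℝ) {γ : Fin s → ℝ} (hγ : ∀ i, 0 ≤ γ i) :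
    (1 : ℝ) ≤ ∏ j, (1 + 2 * γ j ^ l * zetaReal (a * l)) := by
  have h := Finset.prod_le_prod (s := (univ : Finset (Fin s))) (f := fun _ => (1 : ℝ))
    (g := fun j => 1 + 2 * γ j ^ l * zetaReal (a * l)) (fun _ _ => zero_le_one) fun j _ => by
      have : 0 ≤ 2 * γ j ^ l * zetaReal (a * l) :=
        mul_nonneg (mul_nonneg zero_le_two (Real.rpow_nonneg (hγ j) l)) (zetaReal_nonneg'' _)
      linarith
  simpa using h

/-- `B_λ² ≥ 0`. [cite: GodaLecuyer2022, Thm. 1] -/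
theorem errorBoundSq_nonneg {s : ℕ} (a : ℝ) {γ : Fin s → ℝ} (hγ : ∀ i, 0 ≤ γ i) {N : ℕ}
    (hN : 2 ≤ N) (l : ℝ) {η : ℝ} (hη : 0 ≤ η) : 0 ≤ errorBoundSq a γ N l η := by
  unfold errorBoundSq
  have h2 : (2 : ℝ) ≤ N := by exact_mod_cast hN
  refine Real.rpow_nonneg (div_nonneg ?_ (mul_nonneg hη (by linarith))) _
  linarith [one_le_prod_weights a l hγ]

/-- **Markov's inequality step of Theorem 1** (the case `r = 1`, [DSWW06]): for prime `N`, product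
weights `γ ≥ 0`, `0 < λ ≤ 1` with `aλ > 1` and `η > 0`, the generating vectors `z ∈ U_N^s` with
`e²_{a,γ}(z) > B_λ²` number at most `η · #U_N^s` ("Markov's inequality ensures that for any
`0 < η < 1`, the probability of having `S_{α,γ}(z) > … =: B(α,γ)` is at most `η` for a random
choice of `z ∈ U_N^s`"). [cite: GodaLecuyer2022, Thm. 1 (proof)] -/
theorem card_filter_errorBoundSq_lt_le {a l : ℝ} (hl0 : 0 < l) (hl1 : l ≤ 1) (hal : 1 < a * l)
    {s : ℕ} {γ : Fin s → ℝ} (hγ : ∀ i, 0 ≤ γ i) {N : ℕ} (hN : N.Prime) {η : ℝ} (hη : 0 < η) :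
    ((#{z ∈ genVectors s N | errorBoundSq a γ N l η < weightedPFigureR a γ z N} : ℕ) : ℝ) ≤
      η * #(genVectors s N) := by
  have h2 : (2 : ℝ) ≤ N := by exact_mod_cast hN.two_le
  have hN1 : (0 : ℝ) < (N : ℝ) - 1 := by linarith
  have hcast : ((N - 1 : ℕ) : ℝ) = (N : ℝ) - 1 := by
    rw [Nat.cast_sub hN.one_lt.le, Nat.cast_one]
  set P := ∏ j, (1 + 2 * γ j ^ l * zetaReal (a * l)) with hP
  set X := (P - 1) / (η * ((N : ℝ) - 1)) with hX
  have hP1 : 1 ≤ P := one_le_prod_weights a l hγ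
  have hX0 : 0 ≤ X := div_nonneg (by linarith) (mul_pos hη hN1).le
  have hT : errorBoundSq a γ N l η = X ^ l⁻¹ := rfl
  have hT0 : 0 ≤ errorBoundSq a γ N l η := by
    rw [hT]
    exact Real.rpow_nonneg hX0 _
  have hTl : errorBoundSq a γ N l η ^ l = X := by
    rw [hT, Real.rpow_inv_rpow hX0 hl0.ne']
  -- the averaging bound for `Σ_z (e²(z))^λ`
  have hchain : ∑ z ∈ genVectors s N, weightedPFigureR a γ z N ^ l ≤
      (#(genVectors s N) : ℝ) * (η * X) := by
    calc ∑ z ∈ genVectors s N, weightedPFigureR a γ z N ^ l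
        ≤ ∑ z ∈ genVectors s N, weightedPFigureR (a * l) (fun i => γ i ^ l) z N :=
          Finset.sum_le_sum fun z _ => weightedPFigureR_rpow_le hl0 hl1 hal hγ z N
      _ ≤ ((N : ℝ) - 1) ^ s * ((P - 1) / ((N : ℝ) - 1)) :=
          sum_genVectors_weightedPFigureR_le hal hN s (fun i => Real.rpow_nonneg (hγ i) l)
      _ = (#(genVectors s N) : ℝ) * (η * X) := by
          rw [card_genVectors, Nat.cast_pow, hcast, hX]
          field_simp
  by_cases hX00 : X = 0
  · -- then every `e²(z)` vanishes and the exceptional set is empty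
    have hsum0 : ∑ z ∈ genVectors s N, weightedPFigureR a γ z N ^ l = 0 :=
      le_antisymm (hchain.trans (by rw [hX00, mul_zero, mul_zero]))
        (Finset.sum_nonneg fun z _ => Real.rpow_nonneg (weightedPFigureR_nonneg a hγ z N) l)
    rw [Finset.sum_eq_zero_iff_of_nonneg
      (fun z _ => Real.rpow_nonneg (weightedPFigureR_nonneg a hγ z N) l)] at hsum0
    have hempty : (genVectors s N).filter
        (fun z => errorBoundSq a γ N l η < weightedPFigureR a γ z N) = ∅ := by
      refine Finset.filter_eq_empty_iff.mpr fun z hz => ?_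
      have h0 : weightedPFigureR a γ z N = 0 :=
        ((Real.rpow_eq_zero_iff_of_nonneg (weightedPFigureR_nonneg a hγ z N)).mp (hsum0 z hz)).1
      rw [h0]
      exact not_lt.mpr hT0
    rw [hempty, card_empty, Nat.cast_zero]
    positivity
  · have hXpos : 0 < X := lt_of_le_of_ne hX0 (Ne.symm hX00)
    have hbad : (#{z ∈ genVectors s N | errorBoundSq a γ N l η < weightedPFigureR a γ z N} : ℝ) * X
        ≤ (#(genVectors s N) : ℝ) * (η * X) := by
      calc (#{z ∈ genVectors s N | errorBoundSq a γ N l η < weightedPFigureR a γ z N} : ℝ) * X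
          = ∑ z ∈ genVectors s N with errorBoundSq a γ N l η < weightedPFigureR a γ z N, X := by
            rw [sum_const, nsmul_eq_mul]
        _ ≤ ∑ z ∈ genVectors s N with errorBoundSq a γ N l η < weightedPFigureR a γ z N,
              weightedPFigureR a γ z N ^ l := by
            refine Finset.sum_le_sum fun z hz => ?_
            rw [mem_filter] at hz
            rw [← hTl]
            exact (Real.rpow_lt_rpow hT0 hz.2 hl0).le
        _ ≤ ∑ z ∈ genVectors s N, weightedPFigureR a γ z N ^ l :=
            Finset.sum_le_sum_of_subset_of_nonneg (filter_subset _ _) fun z _ _ =>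
              Real.rpow_nonneg (weightedPFigureR_nonneg a hγ z N) l
        _ ≤ _ := hchain
    have : (#{z ∈ genVectors s N | errorBoundSq a γ N l η < weightedPFigureR a γ z N} : ℝ) ≤
        (#(genVectors s N) : ℝ) * η := by
      rw [← mul_assoc] at hbad
      exact le_of_mul_le_mul_right hbad hXpos
    linarith

/-- **Remark 3** (the case `r = 1`): a proportion `≥ 1 - η` of the generating vectors
`z ∈ U_N^s` satisfies `e²_{a,γ}(z) ≤ B_λ²` ("a proportion of the generating vectors `z` which
satisfy the bound of order `N^{-α+ε}` … is greater than or equal to `1 - η`").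
[cite: GodaLecuyer2022, Remark 3] -/
theorem card_filter_le_errorBoundSq_ge {a l : ℝ} (hl0 : 0 < l) (hl1 : l ≤ 1) (hal : 1 < a * l)
    {s : ℕ} {γ : Fin s → ℝ} (hγ : ∀ i, 0 ≤ γ i) {N : ℕ} (hN : N.Prime) {η : ℝ} (hη : 0 < η) :
    (1 - η) * #(genVectors s N) ≤
      ((#{z ∈ genVectors s N | weightedPFigureR a γ z N ≤ errorBoundSq a γ N l η} : ℕ) : ℝ) := by
  have h1 := card_filter_errorBoundSq_lt_le hl0 hl1 hal hγ hN hη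
  have h2 := Finset.card_filter_add_card_filter_not (s := genVectors s N)
    (fun z => weightedPFigureR a γ z N ≤ errorBoundSq a γ N l η)
  simp only [not_le] at h2
  have h3 : ((#{z ∈ genVectors s N | weightedPFigureR a γ z N ≤ errorBoundSq a γ N l η} : ℕ) : ℝ)
      + ((#{z ∈ genVectors s N | errorBoundSq a γ N l η < weightedPFigureR a γ z N} : ℕ) : ℝ)
      = #(genVectors s N) := by
    exact_mod_cast h2
  linarith

end Averaging

/-! ### The Korobov norm and the Cauchy–Schwarz step (4) -/

section ErrorBound

variable {d : Type*} [Fintype d]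

/-- The squared Korobov norm `(‖f‖^Kor_{s,α,γ})² = Σ_{k ∈ ℤˢ} |f̂(k)|² / (r_{α,γ}(k))²`
(Definition 2), in the parametrisation `(r_{α,γ}(k))² = korobovWeightR a γ k` (`a = 2α`,
`γ_j ↦ γ_j²`). [cite: GodaLecuyer2022, Def. 2] -/
def korobovNormSq (a : ℝ) (γ : d → ℝ) (f : C(UnitAddTorus d, ℂ)) : ℝ :=
  ∑' h : d → ℤ, ‖mFourierCoeff f h‖ ^ 2 / korobovWeightR a γ h

/-- `r_{a,γ}(q)^{-1} > 0` for a positive weight. [folklore] -/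
private theorem korobovFactor_pos (a : ℝ) {γ : ℝ} (hγ : 0 < γ) (q : ℤ) : 0 < korobovFactor a γ q := by
  unfold korobovFactor
  split_ifs with hq
  · exact one_pos
  · have : (0 : ℝ) < |(q : ℝ)| := abs_pos.mpr (by exact_mod_cast hq)
    exact div_pos hγ (Real.rpow_pos_of_pos this a)

/-- `(r_{α,γ}(k))² > 0` for positive weights. [cite: GodaLecuyer2022, Def. 2] -/
theorem korobovWeightR_pos (a : ℝ) {γ : d → ℝ} (hγ : ∀ i, 0 < γ i) (h : d → ℤ) :
    0 < korobovWeightR a γ h :=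
  Finset.prod_pos fun i _ => korobovFactor_pos a (hγ i) (h i)

/-- `(‖f‖^Kor)² ≥ 0`. [cite: GodaLecuyer2022, Def. 2] -/
theorem korobovNormSq_nonneg (a : ℝ) {γ : d → ℝ} (hγ : ∀ i, 0 < γ i) (f : C(UnitAddTorus d, ℂ)) :
    0 ≤ korobovNormSq a γ f :=
  tsum_nonneg fun h => div_nonneg (sq_nonneg _) (korobovWeightR_pos a hγ h).le

/-- AM–GM: `x ≤ (x²/w + w)/2` for `w > 0`. [folklore] -/
private theorem le_sq_div_add (x : ℝ) {w : ℝ} (hw : 0 < w) : x ≤ (x ^ 2 / w + w) / 2 := by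
  have h : (x ^ 2 / w + w) / 2 - x = (x - w) ^ 2 / (2 * w) := by
    field_simp
    ring
  have h2 : 0 ≤ (x - w) ^ 2 / (2 * w) := by positivity
  linarith

/-- "any `f ∈ F^Kor_{s,α,γ}` has an absolutely convergent Fourier series" (`α > 1/2`, i.e.
`a > 1`): finiteness of the Korobov norm implies `Σ_k |f̂(k)| < ∞`.
[cite: GodaLecuyer2022, Thm. 1 (proof)] -/
theorem summable_mFourierCoeff_of_korobovNormSq {a : ℝ} (ha : 1 < a) {γ : d → ℝ}
    (hγ : ∀ i, 0 < γ i) {f : C(UnitAddTorus d, ℂ)}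
    (hf : Summable fun h : d → ℤ => ‖mFourierCoeff f h‖ ^ 2 / korobovWeightR a γ h) :
    Summable (mFourierCoeff f) := by
  refine Summable.of_norm_bounded ((hf.add (summable_korobovWeightR ha γ)).div_const 2) fun h => ?_
  exact le_sq_div_add _ (korobovWeightR_pos a hγ h)

/-- **The Cauchy–Schwarz step (4)** of the proof of Theorem 1: for `f` of finite Korobov norm and
any generating vector `z`,
`|Q_{P_{N,s,z}}(f) - I(f)| ≤ Σ_{0 ≠ k ∈ P^⊥} |f̂(k)| ≤ ‖f‖^Kor · S_{α,γ}(z)`, where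
`S_{α,γ}(z)² = Σ_{0 ≠ k ∈ P^⊥} (r_{α,γ}(k))² = e²_{a,γ}(z)`. [cite: GodaLecuyer2022, Thm. 1 (proof)] -/
theorem norm_latticeRule_sub_integral_le_sqrt_mul_sqrt {a : ℝ} (ha : 1 < a) {γ : d → ℝ}
    (hγ : ∀ i, 0 < γ i) (N : ℕ) [NeZero N] (z : d → ℤ) {f : C(UnitAddTorus d, ℂ)}
    (hf : Summable fun h : d → ℤ => ‖mFourierCoeff f h‖ ^ 2 / korobovWeightR a γ h) :
    ‖latticeRule N z f - ∫ x, f x‖ ≤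
      Real.sqrt (korobovNormSq a γ f) * Real.sqrt (weightedPFigureR a γ z N) := by
  have hsum := summable_mFourierCoeff_of_korobovNormSq ha hγ hf
  refine (norm_latticeRule_sub_integral_le N z hsum).trans ?_
  refine Real.tsum_le_of_sum_le (fun h => norm_nonneg _) fun F => ?_
  -- Cauchy–Schwarz on the finite partial sum
  have hγ0 : ∀ i, 0 ≤ γ i := fun i => (hγ i).le
  have h1 : ∀ h : ((dualLattice N z : Set (d → ℤ)) \ {0} : Set (d → ℤ)),
      ‖mFourierCoeff f h‖ =
        Real.sqrt (‖mFourierCoeff f h‖ ^ 2 / korobovWeightR a γ h) *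
          Real.sqrt (korobovWeightR a γ h) := by
    intro h
    have hw := korobovWeightR_pos a hγ (h : d → ℤ)
    rw [← Real.sqrt_mul (div_nonneg (sq_nonneg _) hw.le), div_mul_cancel₀ _ hw.ne',
      Real.sqrt_sq (norm_nonneg _)]
  calc ∑ h ∈ F, ‖mFourierCoeff f h‖
      = ∑ h ∈ F, Real.sqrt (‖mFourierCoeff f h‖ ^ 2 / korobovWeightR a γ h) *
          Real.sqrt (korobovWeightR a γ h) := Finset.sum_congr rfl fun h _ => h1 h
    _ ≤ Real.sqrt (∑ h ∈ F, ‖mFourierCoeff f h‖ ^ 2 / korobovWeightR a γ h) *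
          Real.sqrt (∑ h ∈ F, korobovWeightR a γ (h : d → ℤ)) :=
        Real.sum_sqrt_mul_sqrt_le F (fun h => div_nonneg (sq_nonneg _)
          (korobovWeightR_pos a hγ _).le) fun h => korobovWeightR_nonneg a hγ0 _
    _ ≤ Real.sqrt (korobovNormSq a γ f) * Real.sqrt (weightedPFigureR a γ z N) := by
        refine mul_le_mul (Real.sqrt_le_sqrt ?_) (Real.sqrt_le_sqrt ?_) (Real.sqrt_nonneg _)
          (Real.sqrt_nonneg _)
        · -- partial sum over a subset of the subtype ≤ full sum over `ℤᵈ`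
          calc ∑ h ∈ F, ‖mFourierCoeff f h‖ ^ 2 / korobovWeightR a γ h
              = ∑ h ∈ F.map (Function.Embedding.subtype _),
                  ‖mFourierCoeff f h‖ ^ 2 / korobovWeightR a γ h := by
                rw [Finset.sum_map]
                rfl
            _ ≤ korobovNormSq a γ f :=
                hf.sum_le_tsum _ fun h _ => div_nonneg (sq_nonneg _) (korobovWeightR_pos a hγ h).le
        · exact (hasSum_weightedPFigureR ha γ z N).summable.sum_le_tsum F
            fun h _ => korobovWeightR_nonneg a hγ0 _

/-! ### Real integrands, the median rule `M_{N,s,r}` and Theorem 1 -/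

/-- The complexification `x ↦ (f(x) : ℂ)` of a real continuous integrand on `𝕋ᵈ` (its Fourier
coefficients `f̂(k)` are those of `f`). [cite: GodaLecuyer2022, §2.1] -/
def toComplex (f : C(UnitAddTorus d, ℝ)) : C(UnitAddTorus d, ℂ) :=
  ⟨fun x => (f x : ℂ), Complex.continuous_ofReal.comp f.continuous⟩

omit [Fintype d] in
/-- `toComplex f x = f x`. [folklore] -/
@[simp] private theorem toComplex_apply (f : C(UnitAddTorus d, ℝ)) (x : UnitAddTorus d) :
    toComplex f x = (f x : ℂ) := rfl

omit [Fintype d] in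
/-- `Q_{N,z}` commutes with complexification. [folklore] -/
private theorem ofReal_latticeRule (N : ℕ) [NeZero N] (z : d → ℤ) (f : C(UnitAddTorus d, ℝ)) :
    ((latticeRule N z f : ℝ) : ℂ) = latticeRule N z (toComplex f) := by
  simp [latticeRule, qmcAverage, Complex.ofReal_sum]

/-- `∫ (f : ℂ) = ((∫ f) : ℂ)`. [folklore] -/
private theorem integral_toComplex (f : C(UnitAddTorus d, ℝ)) :
    ∫ x, toComplex f x = ((∫ x, f x : ℝ) : ℂ) := by
  simp only [toComplex_apply]
  exact integral_ofReal

/-- Real form of the Cauchy–Schwarz step: `|Q_{P_{N,s,z}}(f) - I_s(f)| ≤ ‖f‖^Kor · S_{α,γ}(z)` for a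
real integrand of finite Korobov norm. [cite: GodaLecuyer2022, Thm. 1 (proof)] -/
theorem abs_latticeRule_sub_integral_le {a : ℝ} (ha : 1 < a) {γ : d → ℝ} (hγ : ∀ i, 0 < γ i)
    (N : ℕ) [NeZero N] (z : d → ℤ) {f : C(UnitAddTorus d, ℝ)}
    (hf : Summable fun h : d → ℤ => ‖mFourierCoeff (toComplex f) h‖ ^ 2 / korobovWeightR a γ h) :
    |latticeRule N z f - ∫ x, f x| ≤
      Real.sqrt (korobovNormSq a γ (toComplex f)) * Real.sqrt (weightedPFigureR a γ z N) := by
  have h := norm_latticeRule_sub_integral_le_sqrt_mul_sqrt ha hγ N z hf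
  rw [← ofReal_latticeRule, integral_toComplex, ← Complex.ofReal_sub, Complex.norm_real,
    Real.norm_eq_abs] at h
  exact h

/-- **The median rank-1 lattice rule** `M_{N,s,r}(f) := median(Q_{P_{N,s,z_1}}(f), …,
Q_{P_{N,s,z_r}}(f))` for `r = 2k+1` generating vectors `z_1, …, z_r`.
[cite: GodaLecuyer2022, §2.1] -/
def medianLatticeRule (N : ℕ) [NeZero N] {k : ℕ} (zs : Fin (2 * k + 1) → d → ℤ)
    (f : UnitAddTorus d → ℝ) : ℝ :=
  median fun ℓ => latticeRule N (zs ℓ) f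

/-- The deterministic part (4) of the proof of Theorem 1: for any `z_1, …, z_r` and any real
integrand of finite Korobov norm,
`|M_{N,s,r}(f) - I_s(f)| = |median_ℓ (Q_ℓ(f) - I(f))| ≤ median_ℓ |Q_ℓ(f) - I(f)|
 ≤ ‖f‖^Kor · median_ℓ S_{α,γ}(z_ℓ)` (Lemma 2, Cauchy–Schwarz, monotonicity of the median).
[cite: GodaLecuyer2022, Thm. 1 (proof)] -/
theorem abs_medianLatticeRule_sub_integral_le {a : ℝ} (ha : 1 < a) {γ : d → ℝ}
    (hγ : ∀ i, 0 < γ i) (N : ℕ) [NeZero N] {k : ℕ} (zs : Fin (2 * k + 1) → d → ℤ)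
    {f : C(UnitAddTorus d, ℝ)}
    (hf : Summable fun h : d → ℤ => ‖mFourierCoeff (toComplex f) h‖ ^ 2 / korobovWeightR a γ h) :
    |medianLatticeRule N zs f - ∫ x, f x| ≤
      Real.sqrt (korobovNormSq a γ (toComplex f)) *
        Real.sqrt (median fun ℓ => weightedPFigureR a γ (zs ℓ) N) := by
  have hK := Real.sqrt_nonneg (korobovNormSq a γ (toComplex f))
  -- `M(f) - I(f) = median_ℓ (Q_ℓ(f) - I(f))`
  have h1 : medianLatticeRule N zs f - ∫ x, f x =
      median (fun ℓ => latticeRule N (zs ℓ) f - ∫ x, f x) := by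
    have hmono : Monotone fun x : ℝ => x - ∫ x, f x := fun x y hxy => sub_le_sub_right hxy _
    exact (median_comp_of_monotone hmono
      (fun ℓ => latticeRule N (zs ℓ) (f : UnitAddTorus d → ℝ))).symm
  rw [h1]
  -- Lemma 2 and the single-rule bounds
  calc |median fun ℓ => latticeRule N (zs ℓ) f - ∫ x, f x|
      ≤ median fun ℓ => |latticeRule N (zs ℓ) f - ∫ x, f x| := abs_median_le_median_abs _
    _ ≤ median fun ℓ => Real.sqrt (korobovNormSq a γ (toComplex f)) *
          Real.sqrt (weightedPFigureR a γ (zs ℓ) N) :=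
        median_mono fun ℓ => abs_latticeRule_sub_integral_le ha hγ N (zs ℓ) hf
    _ = Real.sqrt (korobovNormSq a γ (toComplex f)) *
          median (fun ℓ => Real.sqrt (weightedPFigureR a γ (zs ℓ) N)) := by
        have hmono : Monotone fun x : ℝ => Real.sqrt (korobovNormSq a γ (toComplex f)) * x :=
          fun x y hxy => mul_le_mul_of_nonneg_left hxy hK
        exact median_comp_of_monotone hmono (fun ℓ => Real.sqrt (weightedPFigureR a γ (zs ℓ) N))
    _ = Real.sqrt (korobovNormSq a γ (toComplex f)) *
          Real.sqrt (median fun ℓ => weightedPFigureR a γ (zs ℓ) N) := by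
        have hmono : Monotone Real.sqrt := fun x y hxy => Real.sqrt_le_sqrt hxy
        rw [median_comp_of_monotone hmono (fun ℓ => weightedPFigureR a γ (zs ℓ) N)]

/-- The sample space of Theorem 1: `Ω = (U_N^s)^r`, all `r = 2k+1`-tuples of generating vectors
("chosen independently and randomly from the set `U_N^s` (with replacement)" = the uniform
distribution on `Ω`). [cite: GodaLecuyer2022, Thm. 1] -/
def draws (s N k : ℕ) : Finset (Fin (2 * k + 1) → Fin s → ℤ) :=
  Fintype.piFinset fun _ : Fin (2 * k + 1) => genVectors s N

/-- `#Ω = ((N-1)^s)^r`. [cite: GodaLecuyer2022, Thm. 1] -/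
theorem card_draws (s N k : ℕ) : (draws s N k).card = ((N - 1) ^ s) ^ (2 * k + 1) := by
  rw [draws, Fintype.card_piFinset, prod_const, card_genVectors, card_univ, Fintype.card_fin]

/-- `1 < aλ`, `0 < λ ≤ 1` imply `a > 1`. [folklore] -/
private theorem one_lt_of_one_lt_mul {a l : ℝ} (hl0 : 0 < l) (hl1 : l ≤ 1) (hal : 1 < a * l) :
    1 < a := by
  have ha0 : 0 < a := lt_of_not_ge fun h => by nlinarith
  nlinarith

/-- **Theorem 1** [cite: GodaLecuyer2022, Thm. 1] (prime `N`, product weights, a fixed exponent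
`λ ∈ (1/(2α), 1]`; `a = 2α`, `r = 2k+1`):
(i) among all draws `ω = (z_1, …, z_r) ∈ Ω = (U_N^s)^r`, those with
`median_ℓ S_{α,γ}(z_ℓ) > B_λ` number at most `binom(r, (r+1)/2) η^{(r+1)/2} · #Ω`
("with a probability of at least `1 - binom(r,(r+1)/2) η^{(r+1)/2}`"); and
(ii) for every other draw the median rule satisfies, for every real integrand `f` of finite
Korobov norm, `|M_{N,s,r}(f) - I_s(f)| ≤ ‖f‖^Kor_{s,α,γ} · B_λ`, i.e.
`e^wor(M_{N,s,r}; F^Kor_{s,α,γ}) ≤ B_λ = ((1/(η φ(N))) (∏_j (1 + 2γ_j^{2λ} ζ(2αλ)) - 1))^{1/(2λ)}`. -/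
theorem medianLatticeRule_theorem_one {a l : ℝ} (hl0 : 0 < l) (hl1 : l ≤ 1) (hal : 1 < a * l)
    {s : ℕ} {γ : Fin s → ℝ} (hγ : ∀ i, 0 < γ i) {N : ℕ} [NeZero N] (hN : N.Prime)
    {η : ℝ} (hη : 0 < η) (k : ℕ) :
    ((#{ω ∈ draws s N k |
        errorBoundSq a γ N l η < median fun ℓ => weightedPFigureR a γ (ω ℓ) N} : ℕ) : ℝ) ≤
        ((2 * k + 1).choose (k + 1) : ℝ) * η ^ (k + 1) * #(draws s N k) ∧
    ∀ ω ∈ draws s N k,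
      ¬ (errorBoundSq a γ N l η < median fun ℓ => weightedPFigureR a γ (ω ℓ) N) →
      ∀ f : C(UnitAddTorus (Fin s), ℝ),
        Summable (fun h : Fin s → ℤ =>
          ‖mFourierCoeff (toComplex f) h‖ ^ 2 / korobovWeightR a γ h) →
        |medianLatticeRule N ω f - ∫ x, f x| ≤
          Real.sqrt (korobovNormSq a γ (toComplex f)) * Real.sqrt (errorBoundSq a γ N l η) := by
  have hγ0 : ∀ i, 0 ≤ γ i := fun i => (hγ i).le
  have ha : 1 < a := one_lt_of_one_lt_mul hl0 hl1 hal
  set T := errorBoundSq a γ N l η with hTdef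
  set Bad := (genVectors s N).filter fun z => T < weightedPFigureR a γ z N with hBad
  refine ⟨?_, ?_⟩
  · -- (i) the counting bound: `median > T` forces `≥ k+1` coordinates in `Bad`
    have hsub : ((draws s N k).filter fun ω => T < median fun ℓ => weightedPFigureR a γ (ω ℓ) N) ⊆
        (Fintype.piFinset fun _ : Fin (2 * k + 1) => genVectors s N).filter
          (fun ω => k + 1 ≤ (univ.filter fun ℓ => ω ℓ ∈ Bad).card) := by
      intro ω hω
      rw [mem_filter] at hω ⊢
      refine ⟨hω.1, ?_⟩
      have h := lt_median_iff.mp hω.2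
      refine h.trans (card_le_card fun ℓ hℓ => ?_)
      simp only [mem_filter, mem_univ, true_and] at hℓ ⊢
      rw [hBad, mem_filter]
      exact ⟨(mem_genVectors.mp ((Fintype.mem_piFinset).mp hω.1 ℓ) |> fun h' => mem_genVectors.mpr h'), hℓ⟩
    have hcount := card_filter_le_card_filter_mem_le (genVectors s N) Bad (2 * k + 1) (k + 1)
    have hmarkov : (Bad.card : ℝ) ≤ η * #(genVectors s N) :=
      card_filter_errorBoundSq_lt_le hl0 hl1 hal hγ0 hN hη
    have hr : 2 * k + 1 - (k + 1) = k := by omega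
    rw [hr] at hcount
    calc ((#{ω ∈ draws s N k |
            T < median fun ℓ => weightedPFigureR a γ (ω ℓ) N} : ℕ) : ℝ)
        ≤ (((2 * k + 1).choose (k + 1) * Bad.card ^ (k + 1) * (genVectors s N).card ^ k : ℕ) : ℝ) := by
          exact_mod_cast (card_le_card hsub).trans hcount
      _ = ((2 * k + 1).choose (k + 1) : ℝ) * (Bad.card : ℝ) ^ (k + 1) *
            ((genVectors s N).card : ℝ) ^ k := by
          push_cast
          ring
      _ ≤ ((2 * k + 1).choose (k + 1) : ℝ) * (η * #(genVectors s N)) ^ (k + 1) *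
            ((genVectors s N).card : ℝ) ^ k := by
          gcongr
      _ = ((2 * k + 1).choose (k + 1) : ℝ) * η ^ (k + 1) * #(draws s N k) := by
          rw [card_draws, Nat.cast_pow, Nat.cast_pow]
          rw [card_genVectors, Nat.cast_pow]
          ring
  · -- (ii) the error bound outside the exceptional set
    intro ω _ hgood f hf
    rw [not_lt] at hgood
    refine (abs_medianLatticeRule_sub_integral_le ha hγ N ω hf).trans ?_
    exact mul_le_mul_of_nonneg_left (Real.sqrt_le_sqrt hgood) (Real.sqrt_nonneg _)

/-- **Corollary 1** [cite: GodaLecuyer2022, Cor. 1] for prime `N` (and product weights), with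
`ρ = 4η`, `r = 2k+1`, exponent `θ = 1/(2λ) = α - ε ∈ [1/2, α)` and the explicit constant
`c_1 = (8 (∏_j (1 + 2γ_j^λ ζ(aλ)) - 1))^{θ}`: the draws violating
`|M_{N,s,r}(f) - I_s(f)| ≤ c_1 (ρN)^{-θ} ‖f‖^Kor` (for some `f`) number at most `(ρ^{(r+1)/2}/4) #Ω`
("`P[e^wor(M_{N,s,r}) ≤ c_1/(ρN)^{α-ε}] ≥ 1 - ρ^{(r+1)/2}/4`"; "For prime `N`, we have
`φ(N) = N - 1` and the corollary follows from Theorem 1 and the bound (7) in Remark 1"). -/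
theorem medianLatticeRule_corollary_one {a l : ℝ} (hl0 : 0 < l) (hl1 : l ≤ 1) (hal : 1 < a * l)
    {s : ℕ} {γ : Fin s → ℝ} (hγ : ∀ i, 0 < γ i) {N : ℕ} [NeZero N] (hN : N.Prime)
    {ρ : ℝ} (hρ : 0 < ρ) (k : ℕ) :
    ∃ E : Finset (Fin (2 * k + 1) → Fin s → ℤ), E ⊆ draws s N k ∧
      ((#E : ℕ) : ℝ) ≤ ρ ^ (k + 1) / 4 * #(draws s N k) ∧
      ∀ ω ∈ draws s N k, ω ∉ E →
        ∀ f : C(UnitAddTorus (Fin s), ℝ),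
          Summable (fun h : Fin s → ℤ =>
            ‖mFourierCoeff (toComplex f) h‖ ^ 2 / korobovWeightR a γ h) →
          |medianLatticeRule N ω f - ∫ x, f x| ≤
            (8 * ((∏ j, (1 + 2 * γ j ^ l * zetaReal (a * l))) - 1)) ^ (2 * l)⁻¹ *
              ((ρ * N) ^ (2 * l)⁻¹)⁻¹ * Real.sqrt (korobovNormSq a γ (toComplex f)) := by
  have hγ0 : ∀ i, 0 ≤ γ i := fun i => (hγ i).le
  have hη : 0 < ρ / 4 := by positivity
  obtain ⟨h1, h2⟩ := medianLatticeRule_theorem_one hl0 hl1 hal hγ hN hη k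
  refine ⟨(draws s N k).filter fun ω =>
      errorBoundSq a γ N l (ρ / 4) < median fun ℓ => weightedPFigureR a γ (ω ℓ) N,
    filter_subset _ _, ?_, ?_⟩
  · refine h1.trans ?_
    have h3 := choose_mul_pow_le k hη.le
    have h4 : (4 * (ρ / 4)) ^ (k + 1) / 4 = ρ ^ (k + 1) / 4 := by
      congr 1
      ring
    rw [h4] at h3
    exact mul_le_mul_of_nonneg_right h3 (Nat.cast_nonneg _)
  · intro ω hω hωE f hf
    have hgood : ¬ (errorBoundSq a γ N l (ρ / 4) < median fun ℓ => weightedPFigureR a γ (ω ℓ) N) := by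
      intro h
      exact hωE (mem_filter.mpr ⟨hω, h⟩)
    refine (h2 ω hω hgood f hf).trans ?_
    -- `√(B²) = X^{1/(2λ)}` and `X = 4(P-1)/(ρ(N-1)) ≤ 8(P-1)/(ρN)`
    have h2N : (2 : ℝ) ≤ N := by exact_mod_cast hN.two_le
    have hN1 : (0 : ℝ) < (N : ℝ) - 1 := by linarith
    set P := ∏ j, (1 + 2 * γ j ^ l * zetaReal (a * l)) with hP
    have hP1 : 1 ≤ P := one_le_prod_weights a l hγ0
    set X := (P - 1) / (ρ / 4 * ((N : ℝ) - 1)) with hX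
    have hX0 : 0 ≤ X := div_nonneg (by linarith) (mul_pos hη hN1).le
    have hθ : 0 ≤ (2 * l)⁻¹ := by positivity
    have hsqrt : Real.sqrt (errorBoundSq a γ N l (ρ / 4)) = X ^ (2 * l)⁻¹ := by
      rw [errorBoundSq, ← hP, ← hX, Real.sqrt_eq_rpow, ← Real.rpow_mul hX0]
      congr 1
      rw [mul_inv, mul_comm]
      norm_num
    have hXle : X ≤ 8 * (P - 1) / (ρ * N) := by
      rw [hX, div_le_div_iff₀ (mul_pos hη hN1) (by positivity)]
      have : (P - 1) * (ρ * N) ≤ (P - 1) * (2 * ρ * ((N : ℝ) - 1)) :=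
        mul_le_mul_of_nonneg_left (by nlinarith) (by linarith)
      nlinarith
    have hrpow : X ^ (2 * l)⁻¹ ≤ (8 * (P - 1)) ^ (2 * l)⁻¹ / (ρ * N) ^ (2 * l)⁻¹ := by
      rw [← Real.div_rpow (by linarith) (by positivity)]
      exact Real.rpow_le_rpow hX0 hXle hθ
    rw [hsqrt]
    calc Real.sqrt (korobovNormSq a γ (toComplex f)) * X ^ (2 * l)⁻¹
        ≤ Real.sqrt (korobovNormSq a γ (toComplex f)) *
            ((8 * (P - 1)) ^ (2 * l)⁻¹ / (ρ * N) ^ (2 * l)⁻¹) :=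
          mul_le_mul_of_nonneg_left hrpow (Real.sqrt_nonneg _)
      _ = (8 * (P - 1)) ^ (2 * l)⁻¹ * ((ρ * N) ^ (2 * l)⁻¹)⁻¹ *
            Real.sqrt (korobovNormSq a γ (toComplex f)) := by
          rw [div_eq_mul_inv]
          ring

end ErrorBound

end Literature.Analysis.Quadrature

end
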